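import Literature.Probability.NegativeDependence.RandomClusterStronglyRayleigh
import Literature.Probability.NegativeDependence.RayleighMeasures
import Literature.Probability.NegativeDependence.RayleighLogSubmodular
import Literature.Combinatorics.StablePolynomials.RealStabilityPreservers
import Literature.Combinatorics.SimpleGraph.CycleMatroidRankFunction
import Literature.Combinatorics.SimpleGraph.TuttePolynomialForestsCycles
import HarnessLib

/-!
# The random cluster model on a cycle: `Z_{C_n}(z,q) = Π_j (q + z_j) + (q − 1) z_1⋯z_n` is Rayleigh but not
# strongly Rayleigh; on a general graph the RC model is strongly Rayleigh iff the graph is acyclic; NLC for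
# `q ≤ 1` (Borcea–Brändén–Liggett §3.4)

J. Borcea, P. Brändén, T. M. Liggett, *Negative dependence and the geometry of polynomials*, J. Amer. Math. Soc.
22 (2009) 521–567 (arXiv:0707.2340, held `paper:arxiv-0707.2340`, arXiv numbering), §3.4 (arXiv p. 13), verbatim:

> The generating polynomial of `μ` is then a constant multiple of the multivariate Tutte polynomial (see [Sokal]):
> `Z_G(z,q) = Σ_{F ⊆ E} q^{k(F)} z^F`, `z = (z_e)_{e∈E}`. If `G = C_n`, `n ≥ 3`, is a cycle and `E = [n]`, then
> `Z_G(z,q) = Π_{j=1}^{n} (q + z_j) + (q − 1) z_1 ⋯ z_n` and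
> `∂Z_G/∂z_1 · ∂Z_G/∂z_2 − Z_G · ∂²Z_G/∂z_1∂z_2 = q² (1 − q) Π_{j=3}^{n} z_j (q + z_j)`,
> so in this case the RC measure is Rayleigh, but not strongly Rayleigh. If `G` is a tree, then
> `Z_G(z,q) = q Π_{e∈E} (q + z_e)`, so the RC model is strongly Rayleigh. We conclude that on a general graph
> `G`, the RC model is strongly Rayleigh if and only if `G` is acyclic.

and (same page, before the display): «If `q ≥ 1`, the RC model satisfies PLC and is therefore positively
associated. If `q ≤ 1`, NLC is satisfied, but other negative correlation properties are largely a matter of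
conjecture.»

## What is here (vocabulary: the tree's `rcWeight G q` = `F ↦ q^{k(F)}` on `2^{E(G)}`, `multiAffine` = generating
## polynomial, `rayleighDiff i j f = ∂_i f ∂_j f − ∂_i∂_j f · f`, `IsRayleigh` (Def. 2.5), `StableOrZero` (strongly
## Rayleigh, Def. 2.10), `IsNLC`, `numComponents` = `k(F)`, `rank ⟨S⟩` of the tree's cycle-matroid files)

* §1 **The printed Rayleigh-difference identity**, for the polynomial `Π_{e∈T} (z_e + q) + (q − 1) Π_{e∈T} z_e` over
  any commutative ring and ANY two indices `i ≠ j` of `T` (the polynomial is symmetric in the `z_e`, so the printed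
  pair `(1,2)` is general): `rayleighDiff_cyclePolynomial`; scaling `rayleighDiff_C_mul`.
* §2 **Sub-edge-sets of a cycle**: for a cycle walk `c` of length `m` in `G` with edge set `T`, every proper
  `S ⊊ T` spans a forest (`k(S) = |V| − |S|`) and `k(T) = |V| − m + 1` (`rank_fromEdgeSet_edges_of_isPath`,
  `isAcyclic_fromEdgeSet_erase_of_isCycle`, `numComponents_add_card_of_ssubset_cycleEdges`,
  `numComponents_cycleEdges`).
* §3 **The coefficient computation** `Σ_{S ⊊ T} q^{a+m−|S|} z^S + q^{a+1} z^T = q^a (Π_{e∈T}(z_e+q) + (q−1) z^T)`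
  (`multiAffine_eq_of_cycleCounts`) and the generating polynomial of the RC weight conditioned on
  «no edge outside the cycle `T`» (`multiAffine_pin_compl_cycleEdges`).
* §4 **`G = C_n` (Mathlib's `cycleGraph (n+3)`) as printed**: `multiAffine_rcWeight_cycleGraph` («`Z_{C_n} = Π(q+z_j)
  + (q−1) z_1⋯z_n`»), `rayleighDiff_multiAffine_rcWeight_cycleGraph` (the display), `isRayleigh_rcWeight_cycleGraph`
  («the RC measure is Rayleigh», `0 ≤ q ≤ 1`), `not_stableOrZero_rcWeight_cycleGraph` («but not strongly Rayleigh»,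
  `0 < q < 1`).
* §5 **«On a general graph `G`, the RC model is strongly Rayleigh iff `G` is acyclic»** (`0 < q`, `q ≠ 1`; for
  `q = 1` the weight is the product weight and is strongly Rayleigh on every graph, `stableOrZero_rcWeight_one`):
  `not_stableOrZero_rcWeight_of_not_isAcyclic`, `stableOrZero_rcWeight_iff_isAcyclic`. Proof as indicated by the
  source («we conclude»): the strongly Rayleigh class is closed under conditioning (tree `stableOrZero_pin`, §4.2);
  conditioning the RC weight of `G` on the absence of every edge off a cycle `T ⊆ E(G)` of length `m` gives
  `q^{|V|−m} Z_{C_m}` in the variables of `T` (§3), whose `(i,j)` Rayleigh difference is negative at a REAL point by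
  §1 (for `q < 1` at `z_k = −q/2`, `z_e = 1` otherwise; for `q > 1` at `z = 𝟙`), contradicting Brändén's criterion
  (tree `rayleighDiff_nonneg_of_isRealStable`, BBL Thm. 4.1). For `q > 1` the same point `z = 𝟙` lies in the open
  orthant, so the RC weight of a non-acyclic graph is then not even Rayleigh (`not_isRayleigh_rcWeight_of_not_isAcyclic`;
  Rayleigh is closed under conditioning by Prop. 2.1 (3), tree `isRayleigh_pin`).
* §6 **«If `q ≤ 1`, NLC is satisfied»** (`isNLC_rcWeight`) and the lattice inequality the other way for `q ≥ 1`
  (`rcWeight_mul_rcWeight_le_of_one_le`, the printed PLC) — both are the submodularity of the rank function of the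
  cycle matroid (tree `rank_fromEdgeSet_submodular`), `k = |V| − rank`.

Theorems only (no definition, no named fact, no instance, no notation); no `sorry`.

## References

* [BorceaBrandenLiggett2007] J. Borcea, P. Brändén, T. M. Liggett, *Negative dependence and the geometry of
  polynomials*, §3.4; Def. 2.5, Def. 2.10, Prop. 2.1 (3), Thm. 4.1, §4.2.
* [Branden2007] P. Brändén, *Polynomials with the half-plane property and matroid theory*, Adv. Math. 216 (2007),
  Thm. 5.6 (the strong Rayleigh inequalities at all real points).
* [GodsilRoyle2001] C. Godsil, G. Royle, *Algebraic Graph Theory*, §15.2 (rank function of the cycle matroid).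
-/

noncomputable section

open Finset MvPolynomial SimpleGraph
open Literature.Combinatorics.StablePolynomials
open Literature.Combinatorics.SimpleGraph.ChromaticPolynomial
open Literature.Combinatorics.SimpleGraph.ElementaryGraphSachs
open Literature.Combinatorics.SimpleGraph.SachsCoefficientConsequences
open Literature.Combinatorics.SimpleGraph.TuttePolynomial

namespace Literature.Probability.NegativeDependence

/-! ## §1 The Rayleigh-difference identity for `Π_{e∈T} (z_e + q) + (q − 1) Π_{e∈T} z_e` -/

section Identity

variable {σ : Type*} {R : Type*} [CommRing R]

/-- A product none of whose factors involves `z_i` has `∂_i = 0`. [folklore] -/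
private theorem pderiv_prod_eq_zero {ι : Type*} [DecidableEq ι] (s : Finset ι) (g : ι → MvPolynomial σ R)
    (i : σ) (h : ∀ e ∈ s, pderiv i (g e) = 0) : pderiv i (∏ e ∈ s, g e) = 0 := by
  induction s using Finset.induction_on with
  | empty => rw [prod_empty, pderiv_one]
  | insert a s ha ih =>
    rw [prod_insert ha, pderiv_mul, h a (mem_insert_self a s), ih fun e he => h e (mem_insert_of_mem he),
      zero_mul, mul_zero, add_zero]

/-- **Scaling**: `Δ_{ij}(c f) = c² Δ_{ij}(f)`. [cite: BorceaBrandenLiggett2007, §2.1 Def. 2.5 (the Rayleigh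
difference)] -/
theorem rayleighDiff_C_mul (i j : σ) (c : R) (f : MvPolynomial σ R) :
    rayleighDiff i j (C c * f) = C (c ^ 2) * rayleighDiff i j f := by
  simp only [rayleighDiff, pderiv_C_mul, map_pow]
  ring

/-- **The printed identity** `∂_i Z · ∂_j Z − Z · ∂_i∂_j Z = q² (1 − q) Π_{e ≠ i,j} z_e (q + z_e)` for
`Z = Π_{e∈T} (q + z_e) + (q − 1) Π_{e∈T} z_e` and any two distinct `i, j ∈ T` (the source displays the pair
`(1,2)`; `Z` is symmetric in its variables). [cite: BorceaBrandenLiggett2007, §3.4 (the display for `G = C_n`,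
arXiv p. 13)] -/
theorem rayleighDiff_cyclePolynomial [DecidableEq σ] (T : Finset σ) (q : R) {i j : σ} (hi : i ∈ T) (hj : j ∈ T) (hij : i ≠ j) :
    rayleighDiff i j (∏ e ∈ T, (X e + C q) + C (q - 1) * ∏ e ∈ T, X e) =
      C (q ^ 2 * (1 - q)) * ∏ e ∈ (T.erase i).erase j, (X e * (X e + C q)) := by
  have hj' : j ∈ T.erase i := mem_erase.2 ⟨hij.symm, hj⟩
  set T₂ := (T.erase i).erase j with hT₂
  set A : MvPolynomial σ R := ∏ e ∈ T₂, (X e + C q) with hA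
  set M : MvPolynomial σ R := ∏ e ∈ T₂, X e with hM
  have hmem : ∀ e ∈ T₂, e ≠ i ∧ e ≠ j := fun e he => by
    obtain ⟨hej, hei⟩ := mem_erase.1 he
    exact ⟨(mem_erase.1 hei).1, hej⟩
  have hAi : pderiv i A = 0 := pderiv_prod_eq_zero _ _ _ fun e he => by
    rw [map_add, pderiv_C, add_zero, pderiv_X_of_ne (hmem e he).1]
  have hAj : pderiv j A = 0 := pderiv_prod_eq_zero _ _ _ fun e he => by
    rw [map_add, pderiv_C, add_zero, pderiv_X_of_ne (hmem e he).2]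
  have hMi : pderiv i M = 0 := pderiv_prod_eq_zero _ _ _ fun e he => pderiv_X_of_ne (hmem e he).1
  have hMj : pderiv j M = 0 := pderiv_prod_eq_zero _ _ _ fun e he => pderiv_X_of_ne (hmem e he).2
  have hprodA : ∏ e ∈ T, (X e + C q) = (X i + C q) * ((X j + C q) * A) := by
    rw [hA, mul_prod_erase (T.erase i) (fun e => X e + C q) hj', mul_prod_erase T (fun e => X e + C q) hi]
  have hprodM : ∏ e ∈ T, X e = X i * (X j * M) := by
    rw [hM, mul_prod_erase (T.erase i) (fun e => X e) hj', mul_prod_erase T (fun e => X e) hi]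
  have hprod2 : ∏ e ∈ T₂, (X e * (X e + C q)) = M * A := by
    rw [hM, hA, ← prod_mul_distrib]
  rw [hprodA, hprodM, hprod2]
  set F : MvPolynomial σ R := (X i + C q) * ((X j + C q) * A) + C (q - 1) * (X i * (X j * M)) with hF
  have hFj : pderiv j F = (X i + C q) * A + C (q - 1) * (X i * M) := by
    simp only [hF, map_add, pderiv_mul, pderiv_C, pderiv_X_self, pderiv_X_of_ne hij, hAj, hMj]
    ring
  have hFi : pderiv i F = (X j + C q) * A + C (q - 1) * (X j * M) := by
    simp only [hF, map_add, pderiv_mul, pderiv_C, pderiv_X_self, pderiv_X_of_ne hij.symm, hAi, hMi]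
    ring
  have hFij : pderiv i (pderiv j F) = A + C (q - 1) * M := by
    rw [hFj]
    simp only [map_add, pderiv_mul, pderiv_C, pderiv_X_self, hAi, hMi]
    ring
  rw [rayleighDiff, hFij, hFi, hFj, hF]
  simp only [map_mul, map_pow, map_sub, C_1]
  ring

end Identity

/-! ## §2 Sub-edge-sets of a cycle: `k(S) = |V| − |S|` for `S ⊊ T`, `k(T) = |V| − m + 1` -/

section CycleEdges

variable {V : Type*} [Fintype V] [DecidableEq V] {G : SimpleGraph V}

omit [Fintype V] [DecidableEq V] in
/-- The edges of a walk are edges of the spanning subgraph they generate. [folklore] -/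
private theorem mem_edgeSet_fromEdgeSet_of_mem_edges {u w : V} (p : G.Walk u w) {S : Finset (Sym2 V)}
    (hS : ∀ e ∈ p.edges, e ∈ S) : ∀ e ∈ p.edges, e ∈ (fromEdgeSet (S : Set (Sym2 V))).edgeSet := by
  intro e he
  rw [edgeSet_fromEdgeSet]
  exact ⟨Finset.mem_coe.2 (hS e he), G.not_isDiag_of_mem_edgeSet (p.edges_subset_edgeSet he)⟩

/-- **The edges of a path are independent in the cycle matroid**: the spanning subgraph on the edge set of a
path of length `ℓ` has rank `ℓ` (each new edge reaches a new vertex). [cite: GodsilRoyle2001, §15.2 («the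
independent sets of `M(X)` are precisely the sets of edges that contain no cycles»)] -/
theorem rank_fromEdgeSet_edges_of_isPath {u w : V} (p : G.Walk u w) (hp : p.IsPath) :
    rank (fromEdgeSet ((p.edges.toFinset : Finset (Sym2 V)) : Set (Sym2 V))) = p.length := by
  induction p with
  | nil =>
    rw [Walk.edges_nil, List.toFinset_nil, Finset.coe_empty, fromEdgeSet_empty,
      Literature.Combinatorics.SimpleGraph.TuttePolynomial.rank_bot, Walk.length_nil]
  | @cons a b c h p ih =>
    rw [Walk.cons_isPath_iff] at hp
    rw [Walk.edges_cons, List.toFinset_cons, Walk.length_cons, rank_fromEdgeSet_insert_of_not_reachable, ih hp.1]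
    rintro ⟨q⟩
    have hq : ¬q.Nil := Walk.not_nil_of_ne h.ne
    have hadj := Walk.adj_snd hq
    rw [fromEdgeSet_adj] at hadj
    exact hp.2 (p.fst_mem_support_of_mem_edges (List.mem_toFinset.1 (Finset.mem_coe.1 hadj.1)))

omit [Fintype V] in
/-- The edge set of a cycle of length `m` has `m` elements. [folklore] -/
private theorem card_edges_toFinset_of_isCycle {v : V} (c : G.Walk v v) (hc : c.IsCycle) :
    #c.edges.toFinset = c.length := by
  rw [List.toFinset_card_of_nodup hc.edges_nodup, Walk.length_edges]

/-- The edge set of a cycle in `G` consists of edges of `G`. [folklore] -/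
private theorem edges_toFinset_subset_edgeFinset [DecidableRel G.Adj] {v : V} (c : G.Walk v v) :
    c.edges.toFinset ⊆ G.edgeFinset := fun _ he =>
  mem_edgeFinset.2 (c.edges_subset_edgeSet (List.mem_toFinset.1 he))

/-- **The edge set `T` of a cycle of length `m` has rank `m − 1`** (the cycle minus its first edge is a path
reaching all its vertices; the first edge joins two already-joined vertices). [cite: GodsilRoyle2001, §15.2] -/
theorem rank_fromEdgeSet_cycleEdges_add_one {v : V} (c : G.Walk v v) (hc : c.IsCycle) :
    rank (fromEdgeSet ((c.edges.toFinset : Finset (Sym2 V)) : Set (Sym2 V))) + 1 = c.length := by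
  cases c with
  | nil => exact absurd hc Walk.not_isCycle_nil
  | @cons a b c h p =>
    obtain ⟨hp, -⟩ := (Walk.cons_isCycle_iff p h).1 hc
    rw [Walk.edges_cons, List.toFinset_cons, Walk.length_cons, rank_fromEdgeSet_insert_of_reachable,
      rank_fromEdgeSet_edges_of_isPath p hp]
    exact ⟨(p.transfer _ (mem_edgeSet_fromEdgeSet_of_mem_edges p fun e he => List.mem_toFinset.2 he)).reverse⟩

/-- **Deleting any one edge from a cycle leaves a forest**: for `e ∈ T`, the edge set of a cycle of `G`, the
spanning subgraph on `T ∖ {e}` is acyclic (its rank is `|T| − 1`: the endpoints of `e` stay joined through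
the rest of the cycle). [cite: GodsilRoyle2001, §15.2] -/
theorem isAcyclic_fromEdgeSet_erase_of_isCycle {v : V} (c : G.Walk v v) (hc : c.IsCycle) {e : Sym2 V}
    (he : e ∈ c.edges.toFinset) :
    (fromEdgeSet (((c.edges.toFinset).erase e : Finset (Sym2 V)) : Set (Sym2 V))).IsAcyclic := by
  set T := c.edges.toFinset with hT
  have hTd : ∀ f ∈ T, ¬f.IsDiag := fun f hf =>
    G.not_isDiag_of_mem_edgeSet (c.edges_subset_edgeSet (List.mem_toFinset.1 hf))
  have hTd' : ∀ f ∈ T.erase e, ¬f.IsDiag := fun f hf => hTd f (mem_of_mem_erase hf)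
  rw [← rank_fromEdgeSet_eq_card_iff_isAcyclic hTd']
  -- the endpoints of `e` are joined in `⟨T ∖ e⟩`
  set H := fromEdgeSet (T : Set (Sym2 V)) with hH
  have hcH : ∀ f ∈ c.edges, f ∈ H.edgeSet := mem_edgeSet_fromEdgeSet_of_mem_edges c fun f hf => List.mem_toFinset.2 hf
  induction e using Sym2.ind with
  | h a b =>
    have key := (adj_and_reachable_delete_edges_iff_exists_cycle (G := H) (v := a) (w := b)).2
      ⟨v, c.transfer H hcH, hc.transfer hcH, by rw [Walk.edges_transfer]; exact List.mem_toFinset.1 he⟩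
    have hreach : (fromEdgeSet ((T.erase s(a, b) : Finset (Sym2 V)) : Set (Sym2 V))).Reachable a b := by
      refine key.2.mono fun x y hxy => ?_
      rw [deleteEdges_adj, hH, fromEdgeSet_adj] at hxy
      rw [fromEdgeSet_adj, Finset.coe_erase]
      exact ⟨⟨hxy.1.1, hxy.2⟩, hxy.1.2⟩
    have h1 := rank_fromEdgeSet_insert_of_reachable hreach
    rw [insert_erase he] at h1
    have h2 := rank_fromEdgeSet_cycleEdges_add_one c hc
    have h3 := card_edges_toFinset_of_isCycle c hc
    have h4 := card_erase_of_mem he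
    rw [← hT] at h2 h3
    omega

/-- **Every proper sub-edge-set of a cycle spans a forest with `|V| − |S|` components**: `k(S) + |S| = |V|` for
`S ⊊ T`. [cite: GodsilRoyle2001, §15.2 («If `A` has `c` components, then `rk(A) = n − c`»)] -/
theorem numComponents_add_card_of_ssubset_cycleEdges {v : V} (c : G.Walk v v) (hc : c.IsCycle)
    {S : Finset (Sym2 V)} (hS : S ⊂ c.edges.toFinset) : numComponents S + #S = Fintype.card V := by
  obtain ⟨e, he, heS⟩ := exists_of_ssubset hS
  have hsub : S ⊆ (c.edges.toFinset).erase e := fun f hf =>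
    mem_erase.2 ⟨fun h => heS (h ▸ hf), hS.1 hf⟩
  have hac : (fromEdgeSet (S : Set (Sym2 V))).IsAcyclic :=
    (isAcyclic_fromEdgeSet_erase_of_isCycle c hc he).anti (fromEdgeSet_mono (Finset.coe_subset.2 hsub))
  exact numComponents_add_card (fun f hf =>
    G.not_isDiag_of_mem_edgeSet (c.edges_subset_edgeSet (List.mem_toFinset.1 (hS.1 hf)))) hac

/-- **The whole cycle has `|V| − m + 1` components**: `k(T) + m = |V| + 1`. [cite: GodsilRoyle2001, §15.2] -/
theorem numComponents_cycleEdges {v : V} (c : G.Walk v v) (hc : c.IsCycle) :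
    numComponents c.edges.toFinset + c.length = Fintype.card V + 1 := by
  have h1 := rank_fromEdgeSet_add_numComponents c.edges.toFinset
  have h2 := rank_fromEdgeSet_cycleEdges_add_one c hc
  omega

omit [DecidableEq V] in
/-- A cycle is no longer than the number of vertices: `m ≤ |V|` (a cycle is an edge followed by a path).
[folklore] -/
private theorem length_le_card_of_isCycle {v : V} (c : G.Walk v v) (hc : c.IsCycle) : c.length ≤ Fintype.card V := by
  cases c with
  | nil => exact absurd hc Walk.not_isCycle_nil
  | cons h p =>
    rw [Walk.length_cons]
    exact ((Walk.cons_isCycle_iff p h).1 hc).1.length_lt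

end CycleEdges

/-! ## §3 The coefficient computation and the conditioned weight -/

section Coefficients

variable {σ : Type*} [Fintype σ] [DecidableEq σ]

/-- **`Σ_{S ⊊ T} q^{a + |T| − |S|} z^S + q^{a+1} z^T = q^a (Π_{e∈T} (z_e + q) + (q − 1) z^T)`**: the generating
polynomial of a weight supported on `2^T` with these values («`Z_{C_n}(z,q) = Π(q+z_j) + (q−1) z_1⋯z_n`»,
with an extra factor `q^a`). [cite: BorceaBrandenLiggett2007, §3.4 (the formula for `Z_{C_n}`)] -/
theorem multiAffine_eq_of_cycleCounts (ν : Finset σ → ℝ) (T : Finset σ) (q : ℝ) (a : ℕ)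
    (h0 : ∀ S, ¬S ⊆ T → ν S = 0) (h1 : ∀ S, S ⊂ T → ν S = q ^ (a + (#T - #S))) (h2 : ν T = q ^ (a + 1)) :
    multiAffine ν = C (q ^ a) * (∏ e ∈ T, (X e + C q) + C (q - 1) * ∏ e ∈ T, X e) := by
  rw [multiAffine, ← sum_subset (subset_univ T.powerset) (fun S _ hS => by
    rw [mem_powerset] at hS; rw [h0 S hS, C_0, zero_mul])]
  rw [prod_add, mul_add, mul_sum, ← sum_erase_add _ _ (mem_powerset_self T),
    ← sum_erase_add (T.powerset) (fun S => C (q ^ a) * ((∏ e ∈ S, X e) * ∏ e ∈ T \ S, C q)) (mem_powerset_self T),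
    Finset.sdiff_self, prod_empty, mul_one, h2, add_assoc]
  congr 1
  · refine sum_congr rfl fun S hS => ?_
    obtain ⟨hne, hS'⟩ := mem_erase.1 hS
    have hsub : S ⊆ T := mem_powerset.1 hS'
    rw [h1 S (hsub.ssubset_of_ne hne), prod_const, card_sdiff_of_subset hsub, pow_add]
    simp only [map_mul, map_pow]
    ring
  · simp only [map_pow, map_sub, C_1]
    ring

variable {V : Type*} [Fintype V] [DecidableEq V] (G : SimpleGraph V) [DecidableRel G.Adj]

/-- `S` avoids the complement of `T` iff `S ⊆ T`. [folklore] -/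
private theorem disjoint_compl_left_iff_subset (T S : Finset (Sym2 V)) : Disjoint Tᶜ S ↔ S ⊆ T := by
  rw [Finset.disjoint_left]
  refine ⟨fun h e he => ?_, fun h e he heS => ?_⟩
  · by_contra heT
    exact h (mem_compl.2 heT) he
  · exact (mem_compl.1 he) (h heS)

/-- **Conditioning the RC weight on the absence of every edge outside `T ⊆ E(G)`** keeps `q^{k(S)}` on
`S ⊆ T` and kills everything else. [cite: BorceaBrandenLiggett2007, §2.1 (conditioning on `X_e = 0`) with §3.4] -/
theorem pin_compl_rcWeight_apply (q : ℝ) {T : Finset (Sym2 V)} (hT : T ⊆ G.edgeFinset) (S : Finset (Sym2 V)) :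
    pin ∅ Tᶜ (rcWeight G q) S = if S ⊆ T then q ^ numComponents S else 0 := by
  rw [pin_apply, rcWeight_apply]
  simp only [empty_subset, true_and, disjoint_compl_left_iff_subset]
  by_cases hS : S ⊆ T
  · rw [if_pos hS, if_pos hS, if_pos (hS.trans hT)]
  · rw [if_neg hS, if_neg hS]

/-- **The RC weight of `G` conditioned on «no edge off the cycle `T`» has generating polynomial
`q^{|V|−m} (Π_{e∈T} (z_e + q) + (q − 1) Π_{e∈T} z_e) = q^{|V|−m} Z_{C_m}`**, `m` the length of the cycle.
[cite: BorceaBrandenLiggett2007, §3.4 (`Z_{C_n}`) with §2.1 (conditioning)] -/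
theorem multiAffine_pin_compl_cycleEdges (q : ℝ) {v : V} (c : G.Walk v v) (hc : c.IsCycle) :
    multiAffine (pin ∅ (c.edges.toFinset)ᶜ (rcWeight G q)) =
      C (q ^ (Fintype.card V - c.length)) *
        (∏ e ∈ c.edges.toFinset, (X e + C q) + C (q - 1) * ∏ e ∈ c.edges.toFinset, X e) := by
  have hT := edges_toFinset_subset_edgeFinset (G := G) c
  have hm := card_edges_toFinset_of_isCycle c hc
  have hle := length_le_card_of_isCycle c hc
  refine multiAffine_eq_of_cycleCounts _ _ q _ (fun S hS => ?_) (fun S hS => ?_) ?_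
  · rw [pin_compl_rcWeight_apply G q hT, if_neg hS]
  · rw [pin_compl_rcWeight_apply G q hT, if_pos hS.1]
    have h := numComponents_add_card_of_ssubset_cycleEdges c hc hS
    have hlt : #S < #c.edges.toFinset := card_lt_card hS
    congr 1
    omega
  · rw [pin_compl_rcWeight_apply G q hT, if_pos Subset.rfl]
    have h := numComponents_cycleEdges c hc
    congr 1
    omega

end Coefficients

/-! ## §4 `G = C_n`: `Z_{C_n} = Π (q + z_j) + (q − 1) z_1⋯z_n` is Rayleigh but not strongly Rayleigh -/

section CycleGraph

variable (n : ℕ) (q : ℝ)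

/-- **«If `G = C_n`, `n ≥ 3`, is a cycle and `E = [n]`, then `Z_G(z,q) = Π_{j=1}^n (q + z_j) + (q − 1) z_1⋯z_n`»**,
for Mathlib's cycle graph `C_N`, `N = n + 3` (variables indexed by the edges of `C_N`). [cite:
BorceaBrandenLiggett2007, §3.4] -/
theorem multiAffine_rcWeight_cycleGraph :
    multiAffine (rcWeight (cycleGraph (n + 3)) q) =
      ∏ e ∈ (cycleGraph (n + 3)).edgeFinset, (X e + C q) + C (q - 1) * ∏ e ∈ (cycleGraph (n + 3)).edgeFinset, X e := by
  have hE := Literature.Combinatorics.SimpleGraph.CycleSpanningTreesCount.card_edgeFinset_cycleGraph (n := n)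
  have h := multiAffine_eq_of_cycleCounts (rcWeight (cycleGraph (n + 3)) q) (cycleGraph (n + 3)).edgeFinset q 0
    (fun S hS => by rw [rcWeight_apply, if_neg hS]) (fun S hS => by
      rw [rcWeight_apply, if_pos hS.1, zero_add]
      obtain ⟨-, hr⟩ := corank_fromEdgeSet_eq_zero_of_ssubset n hS
      have h1 := rank_fromEdgeSet_add_numComponents S
      rw [hr, Fintype.card_fin] at h1
      congr 1
      omega) (by
      rw [rcWeight_apply, if_pos Subset.rfl, zero_add, pow_one]
      have h1 := rank_fromEdgeSet_add_numComponents (cycleGraph (n + 3)).edgeFinset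
      rw [rank_fromEdgeSet_edgeFinset, (rank_cycleGraph n).1, Fintype.card_fin] at h1
      have h2 : numComponents (cycleGraph (n + 3)).edgeFinset = 1 := by omega
      rw [h2, pow_one])
  rw [h, pow_zero, C_1, one_mul]

/-- **The printed display**: for two distinct edges `i ≠ j` of `C_N`,
`∂_i Z ∂_j Z − Z ∂_i∂_j Z = q² (1 − q) Π_{e ≠ i, j} z_e (q + z_e)`, `Z = Z_{C_N}(z,q)`.
[cite: BorceaBrandenLiggett2007, §3.4 (display, arXiv p. 13)] -/
theorem rayleighDiff_multiAffine_rcWeight_cycleGraph {i j : Sym2 (Fin (n + 3))}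
    (hi : i ∈ (cycleGraph (n + 3)).edgeFinset) (hj : j ∈ (cycleGraph (n + 3)).edgeFinset) (hij : i ≠ j) :
    rayleighDiff i j (multiAffine (rcWeight (cycleGraph (n + 3)) q)) =
      C (q ^ 2 * (1 - q)) * ∏ e ∈ ((cycleGraph (n + 3)).edgeFinset.erase i).erase j, (X e * (X e + C q)) := by
  rw [multiAffine_rcWeight_cycleGraph, rayleighDiff_cyclePolynomial _ q hi hj hij]

variable {V : Type*} [Fintype V] [DecidableEq V]

omit [Fintype V] in
/-- If `μ` gives no mass to the sets containing `e`, then `∂_e μ = 0`. [cite: BorceaBrandenLiggett2007, §2.1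
(conditioning on `X_e = 1`: `∂_e g_μ`)] -/
theorem derivWeight_eq_zero_of_forall {μ : Finset V → ℝ} {e : V} (h : ∀ S, e ∈ S → μ S = 0) :
    derivWeight e μ = 0 := by
  funext S
  rw [derivWeight_apply, Pi.zero_apply]
  split_ifs with heS
  · rfl
  · exact h _ (mem_insert_self e S)

omit [Fintype V] in
/-- `∂_j μ` still gives no mass to the sets containing `e`. [cite: BorceaBrandenLiggett2007, §2.1] -/
theorem derivWeight_apply_eq_zero_of_forall {μ : Finset V → ℝ} {e : V} (h : ∀ S, e ∈ S → μ S = 0) (j : V)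
    (S : Finset V) (heS : e ∈ S) : derivWeight j μ S = 0 := by
  rw [derivWeight_apply]
  split_ifs with hjS
  · rfl
  · exact h _ (mem_insert_of_mem heS)

omit [DecidableEq V] in
/-- The generating polynomial of the zero weight. [folklore] -/
private theorem multiAffine_zero' : multiAffine (0 : Finset V → ℝ) = 0 := by
  simp [multiAffine]

/-- **A Rayleigh difference in a direction carrying no mass vanishes**: if `μ(S) = 0` whenever `e ∈ S`, then
`Δ_{ej}(g_μ)(x) = 0` and `Δ_{ie}(g_μ)(x) = 0`. [cite: BorceaBrandenLiggett2007, §2.1 Def. 2.5] -/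
theorem eval_rayleighDiff_multiAffine_eq_zero_of_forall {μ : Finset V → ℝ} {e : V}
    (h : ∀ S, e ∈ S → μ S = 0) (j : V) (x : V → ℝ) :
    MvPolynomial.eval x (rayleighDiff e j (multiAffine μ)) = 0 ∧
      MvPolynomial.eval x (rayleighDiff j e (multiAffine μ)) = 0 := by
  have h1 : derivWeight e μ = 0 := derivWeight_eq_zero_of_forall h
  have h2 : derivWeight e (derivWeight j μ) = 0 :=
    derivWeight_eq_zero_of_forall fun S heS => derivWeight_apply_eq_zero_of_forall h j S heS
  have h3 : derivWeight j (derivWeight e μ) = 0 := by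
    rw [h1]; funext S; simp [derivWeight_apply]
  rw [eval_rayleighDiff_multiAffine, eval_rayleighDiff_multiAffine, h2, h3, h1, multiAffine_zero', map_zero]
  exact ⟨by ring, by ring⟩

/-- **«so in this case the RC measure is Rayleigh»** (`0 ≤ q ≤ 1`): every Rayleigh difference of `Z_{C_N}` is
nonnegative on the positive orthant — for two distinct edges by the display (`1 − q ≥ 0`), for `i = j` because
`Z` is multi-affine (`Δ_{ii} = (∂_i Z)²`), and trivially in the directions of non-edges.
[cite: BorceaBrandenLiggett2007, §3.4 with Def. 2.5] -/
theorem isRayleigh_rcWeight_cycleGraph (hq0 : 0 ≤ q) (hq1 : q ≤ 1) : IsRayleigh (rcWeight (cycleGraph (n + 3)) q) := by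
  intro x hx i j
  set E := (cycleGraph (n + 3)).edgeFinset with hE
  have hout : ∀ e : Sym2 (Fin (n + 3)), e ∉ E → ∀ S, e ∈ S → rcWeight (cycleGraph (n + 3)) q S = 0 :=
    fun e he S heS => by rw [rcWeight_apply, if_neg fun hS => he (hS heS)]
  by_cases hi : i ∈ E
  · by_cases hj : j ∈ E
    · rcases eq_or_ne i j with rfl | hij
      · have hma := isMultiAffine_multiAffine_real (rcWeight (cycleGraph (n + 3)) q)
        simp only [rayleighDiff, pderiv_pderiv_self_of_isMultiAffine hma i, zero_mul, sub_zero, map_mul]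
        exact mul_self_nonneg _
      · rw [rayleighDiff_multiAffine_rcWeight_cycleGraph n q hi hj hij, map_mul, eval_C, map_prod]
        refine mul_nonneg (mul_nonneg (sq_nonneg q) (by linarith)) (prod_nonneg fun e _ => ?_)
        rw [map_mul, map_add, eval_X, eval_C]
        exact mul_nonneg (hx e).le (by linarith [hx e])
    · exact ((eval_rayleighDiff_multiAffine_eq_zero_of_forall (hout j hj) i x).2).ge
  · exact ((eval_rayleighDiff_multiAffine_eq_zero_of_forall (hout i hi) j x).1).ge

end CycleGraph

/-! ## §5 «The RC model is strongly Rayleigh if and only if `G` is acyclic» -/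

section General

variable {V : Type*} [Fintype V] [DecidableEq V] (G : SimpleGraph V) [DecidableRel G.Adj] {q : ℝ}

/-- The key sign computation: at a cycle `T` of `G` of length `m ≥ 3` and two distinct edges `i ≠ j` of `T`, the
`(i,j)` Rayleigh difference of the conditioned weight `q^{|V|−m} Z_{C_m}` is NEGATIVE at some real point
(`0 < q`, `q ≠ 1`): at `z_k = −q/2`, `z = 1` elsewhere if `q < 1`, at `z = 𝟙` if `q > 1`; in the latter case the
point is in the open orthant. [cite: BorceaBrandenLiggett2007, §3.4 (display: `q²(1−q) Π_{j≥3} z_j(q+z_j)`)] -/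
theorem exists_eval_rayleighDiff_pin_neg (hq0 : 0 < q) (hq1 : q ≠ 1) {v : V} (c : G.Walk v v) (hc : c.IsCycle) :
    ∃ (i j : Sym2 V) (x : Sym2 V → ℝ), (1 < q → ∀ e, 0 < x e) ∧
      MvPolynomial.eval x (rayleighDiff i j (multiAffine (pin ∅ (c.edges.toFinset)ᶜ (rcWeight G q)))) < 0 := by
  -- three distinct edges of the cycle
  have hcard : 3 ≤ #c.edges.toFinset := by rw [card_edges_toFinset_of_isCycle c hc]; exact hc.three_le_length
  obtain ⟨i, hi, j, hj, k, hk, hij, hik, hjk⟩ : ∃ i ∈ c.edges.toFinset, ∃ j ∈ c.edges.toFinset, ∃ k ∈ c.edges.toFinset, i ≠ j ∧ i ≠ k ∧ j ≠ k := by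
    obtain ⟨U, hUT, hU⟩ := exists_subset_card_eq hcard
    obtain ⟨i, j, k, hij, hik, hjk, hUeq⟩ := card_eq_three.1 hU
    refine ⟨i, hUT ?_, j, hUT ?_, k, hUT ?_, hij, hik, hjk⟩ <;> simp [hUeq]
  have hk2 : k ∈ ((c.edges.toFinset).erase i).erase j := mem_erase.2 ⟨hjk.symm, mem_erase.2 ⟨hik.symm, hk⟩⟩
  have hpos : 0 < (q ^ (Fintype.card V - c.length)) ^ 2 := by positivity
  -- the `(i,j)` Rayleigh difference of `q^{|V|-m} Z_{C_m}` at a point `x`, as a product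
  have key : ∀ x : Sym2 V → ℝ, MvPolynomial.eval x (rayleighDiff i j (multiAffine (pin ∅ (c.edges.toFinset)ᶜ (rcWeight G q)))) =
      (q ^ (Fintype.card V - c.length)) ^ 2 * (q ^ 2 * (1 - q) *
        (x k * (x k + q) * ∏ e ∈ (((c.edges.toFinset).erase i).erase j).erase k, (x e * (x e + q)))) := fun x => by
    rw [multiAffine_pin_compl_cycleEdges G q c hc, rayleighDiff_C_mul,
      rayleighDiff_cyclePolynomial _ q hi hj hij, map_mul, map_mul, eval_C, eval_C, map_prod,
      ← mul_prod_erase _ _ hk2]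
    simp only [map_mul, map_add, eval_X, eval_C]
  by_cases h1 : 1 < q
  · -- `q > 1`: the point `z = 𝟙` of the open orthant
    refine ⟨i, j, fun _ => 1, fun _ _ => one_pos, ?_⟩
    rw [key]
    have hprod : 0 < ∏ _e ∈ (((c.edges.toFinset).erase i).erase j).erase k, ((1 : ℝ) * (1 + q)) := prod_pos fun e _ => by nlinarith
    have hneg : q ^ 2 * (1 - q) < 0 := mul_neg_of_pos_of_neg (by positivity) (by linarith)
    have h1q : 0 < (1 : ℝ) * (1 + q) := by nlinarith
    nlinarith [mul_neg_of_neg_of_pos hneg (mul_pos hpos (mul_pos h1q hprod))]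
  · -- `q < 1`: the real point `z_k = -q/2`, `z_e = 1` otherwise
    have hq1' : q < 1 := lt_of_le_of_ne (not_lt.1 h1) hq1
    refine ⟨i, j, Function.update (fun _ => (1 : ℝ)) k (-q / 2), fun h => absurd h h1, ?_⟩
    rw [key, Function.update_self]
    have hprod : 0 < ∏ e ∈ (((c.edges.toFinset).erase i).erase j).erase k, (Function.update (fun _ => (1 : ℝ)) k (-q / 2) e *
        (Function.update (fun _ => (1 : ℝ)) k (-q / 2) e + q)) :=
      prod_pos fun e he => by
        simp only [Function.update_of_ne (mem_erase.1 he).1]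
        nlinarith
    have hpos2 : 0 < q ^ 2 * (1 - q) := mul_pos (by positivity) (by linarith)
    have hneg : -q / 2 * (-q / 2 + q) < 0 := by nlinarith
    nlinarith [mul_neg_of_neg_of_pos hneg (mul_pos (mul_pos hpos hpos2) hprod)]

/-- **A graph with a cycle has a non-strongly-Rayleigh RC weight** (`0 < q`, `q ≠ 1`): conditioning on the absence
of the edges off a cycle (closedness of the strongly Rayleigh class under conditioning, §4.2) yields
`q^{|V|−m} Z_{C_m}`, which violates Brändén's criterion (Thm. 4.1) at the point of
`exists_eval_rayleighDiff_pin_neg`. [cite: BorceaBrandenLiggett2007, §3.4 («the RC model is strongly Rayleigh if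
and only if G is acyclic») with Thm. 4.1 and §4.2; Branden2007, Thm. 5.6] -/
theorem not_stableOrZero_rcWeight_of_not_isAcyclic (hq0 : 0 < q) (hq1 : q ≠ 1) (hG : ¬G.IsAcyclic) :
    ¬StableOrZero (rcWeight G q) := by
  intro hst
  obtain ⟨v, c, hc⟩ : ∃ (v : V) (c : G.Walk v v), c.IsCycle := by
    by_contra h
    push Not at h
    exact hG fun v c hc => h v c hc
  obtain ⟨i, j, x, -, hneg⟩ := exists_eval_rayleighDiff_pin_neg G hq0 hq1 c hc
  have hpin := stableOrZero_pin hst ∅ (c.edges.toFinset)ᶜ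
  rcases (stableOrZero_iff _).1 hpin with h0 | hs
  · rw [h0] at hneg
    simp [rayleighDiff] at hneg
  · exact absurd hneg (not_lt.2 (rayleighDiff_nonneg_of_isRealStable (isMultiAffine_multiAffine_real _) hs x i j))

/-- **«On a general graph `G`, the RC model is strongly Rayleigh if and only if `G` is acyclic»** (`0 < q`,
`q ≠ 1`; the forest direction is the tree's `stableOrZero_rcWeight_of_isAcyclic`).
[cite: BorceaBrandenLiggett2007, §3.4] -/
theorem stableOrZero_rcWeight_iff_isAcyclic (hq0 : 0 < q) (hq1 : q ≠ 1) :
    StableOrZero (rcWeight G q) ↔ G.IsAcyclic :=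
  ⟨fun h => by_contra fun hG => not_stableOrZero_rcWeight_of_not_isAcyclic G hq0 hq1 hG h,
    fun hG => stableOrZero_rcWeight_of_isAcyclic G hG hq0⟩

/-- **«but not strongly Rayleigh»**: the RC weight of the cycle `C_N` (`N ≥ 3`, `0 < q < 1`) is not strongly
Rayleigh. [cite: BorceaBrandenLiggett2007, §3.4] -/
theorem not_stableOrZero_rcWeight_cycleGraph (n : ℕ) (hq0 : 0 < q) (hq1 : q < 1) :
    ¬StableOrZero (rcWeight (cycleGraph (n + 3)) q) := by
  refine not_stableOrZero_rcWeight_of_not_isAcyclic _ hq0 hq1.ne fun hac => ?_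
  have h := (corank_eq_zero_iff_isAcyclic (cycleGraph (n + 3))).2 hac
  have h2 := (rank_cycleGraph n).2
  omega

/-- The scope of «iff acyclic»: at `q = 1` the RC weight is the product weight `F ↦ 1` on `2^{E(G)}`, whose
generating polynomial `Π_{e∈E} (1 + z_e)` is stable for EVERY graph. [cite: BorceaBrandenLiggett2007, §3.4
(`Z_G(z,q)` at `q = 1`) with §2.2 (products of stable polynomials)] -/
theorem stableOrZero_rcWeight_one : StableOrZero (rcWeight G 1) := by
  have hmA : multiAffine (rcWeight G 1) = ∏ e ∈ G.edgeFinset, (X e + C 1) := by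
    rw [multiAffine, prod_add, ← sum_subset (subset_univ G.edgeFinset.powerset)]
    · refine sum_congr rfl fun A hA => ?_
      rw [mem_powerset] at hA
      rw [rcWeight_apply, if_pos hA, one_pow, C_1, one_mul, prod_const, one_pow, mul_one]
    · intro A _ hA
      rw [mem_powerset] at hA
      rw [rcWeight_apply, if_neg hA, C_0, zero_mul]
  rw [stableOrZero_iff]
  refine Or.inr ((isRealStable_iff _).2 fun z hz => ?_)
  rw [hmA, eval₂_prod]
  refine prod_ne_zero_iff.2 fun e _ => ?_
  rw [eval₂_add, eval₂_C, eval₂_X, map_one]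
  intro h
  have him := congrArg Complex.im h
  rw [Complex.add_im, Complex.one_im, Complex.zero_im] at him
  linarith [hz e]

/-- For `q > 1` a graph with a cycle has an RC weight that is **not even Rayleigh** (the printed display is
negative on the whole positive orthant when `1 − q < 0`; Rayleigh is closed under conditioning, Prop. 2.1 (3)).
[cite: BorceaBrandenLiggett2007, §3.4 (display) with Prop. 2.1 (3)] -/
theorem not_isRayleigh_rcWeight_of_not_isAcyclic (hq1 : 1 < q) (hG : ¬G.IsAcyclic) : ¬IsRayleigh (rcWeight G q) := by
  intro hR
  obtain ⟨v, c, hc⟩ : ∃ (v : V) (c : G.Walk v v), c.IsCycle := by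
    by_contra h
    push Not at h
    exact hG fun v c hc => h v c hc
  obtain ⟨i, j, x, hx, hneg⟩ := exists_eval_rayleighDiff_pin_neg G (by linarith) hq1.ne' c hc
  exact absurd hneg (not_lt.2 ((isRayleigh_pin hR ∅ (c.edges.toFinset)ᶜ) x (hx hq1) i j))

end General

/-! ## §6 «If `q ≤ 1`, NLC is satisfied» — submodularity of the rank of the cycle matroid -/

section NLC

variable {V : Type*} [Fintype V] [DecidableEq V] (G : SimpleGraph V) [DecidableRel G.Adj] {q : ℝ}

/-- **`k` is supermodular**: `k(S ∪ T) + k(S ∩ T) ≥ k(S) + k(T)` (`k = |V| − rank`, and the rank of the cycle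
matroid is submodular). [cite: GodsilRoyle2001, §15.2 with §15.1 (R2) (submodularity); BorceaBrandenLiggett2007,
§3.4 («If q ≤ 1, NLC is satisfied»)] -/
theorem numComponents_add_le_union_add_inter (S T : Finset (Sym2 V)) :
    numComponents S + numComponents T ≤ numComponents (S ∪ T) + numComponents (S ∩ T) := by
  have h := rank_fromEdgeSet_submodular S T
  have h1 := rank_fromEdgeSet_add_numComponents S
  have h2 := rank_fromEdgeSet_add_numComponents T
  have h3 := rank_fromEdgeSet_add_numComponents (S ∪ T)
  have h4 := rank_fromEdgeSet_add_numComponents (S ∩ T)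
  omega

/-- **«If `q ≤ 1`, NLC is satisfied»**: `μ(S ∪ T) μ(S ∩ T) ≤ μ(S) μ(T)` for the RC weight `μ(F) = q^{k(F)}`
(`0 ≤ q ≤ 1`). [cite: BorceaBrandenLiggett2007, §3.4] -/
theorem isNLC_rcWeight (hq0 : 0 ≤ q) (hq1 : q ≤ 1) : IsNLC (rcWeight G q) := by
  intro S T
  by_cases hS : S ⊆ G.edgeFinset
  · by_cases hT : T ⊆ G.edgeFinset
    · rw [rcWeight_apply, if_pos (union_subset hS hT), rcWeight_apply, if_pos (inter_subset_left.trans hS),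
        rcWeight_apply, if_pos hS, rcWeight_apply, if_pos hT, ← pow_add, ← pow_add]
      exact pow_le_pow_of_le_one hq0 hq1 (numComponents_add_le_union_add_inter S T)
    · rw [rcWeight_apply G q (S ∪ T), if_neg fun h => hT (subset_union_right.trans h), zero_mul]
      exact mul_nonneg (rcWeight_nonneg G hq0 S) (rcWeight_nonneg G hq0 T)
  · rw [rcWeight_apply G q (S ∪ T), if_neg fun h => hS (subset_union_left.trans h), zero_mul]
    exact mul_nonneg (rcWeight_nonneg G hq0 S) (rcWeight_nonneg G hq0 T)

/-- **«If `q ≥ 1`, the RC model satisfies PLC»** (the positive lattice condition): `μ(S) μ(T) ≤ μ(S ∪ T) μ(S ∩ T)`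
for edge sets `S, T ⊆ E(G)` and `q ≥ 1`. [cite: BorceaBrandenLiggett2007, §3.4] -/
theorem rcWeight_mul_rcWeight_le_of_one_le (hq1 : 1 ≤ q) {S T : Finset (Sym2 V)} (hS : S ⊆ G.edgeFinset)
    (hT : T ⊆ G.edgeFinset) :
    rcWeight G q S * rcWeight G q T ≤ rcWeight G q (S ∪ T) * rcWeight G q (S ∩ T) := by
  rw [rcWeight_apply G q (S ∪ T), if_pos (union_subset hS hT), rcWeight_apply G q (S ∩ T),
    if_pos (inter_subset_left.trans hS), rcWeight_apply G q S, if_pos hS, rcWeight_apply G q T, if_pos hT,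
    ← pow_add, ← pow_add]
  exact pow_le_pow_right₀ hq1 (numComponents_add_le_union_add_inter S T)

end NLC

end Literature.Probability.NegativeDependence
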